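import Mathlib.Topology.Algebra.OpenSubgroup
import Mathlib.Topology.Algebra.ContinuousMonoidHom
import Mathlib.Topology.MetricSpace.Ultra.Basic
import Mathlib.GroupTheory.Index
import Mathlib.GroupTheory.Perm.Cycle.Type
import Mathlib.NumberTheory.Padics.RingHoms
import Mathlib.NumberTheory.Padics.ProperSpace
import Mathlib.Data.Nat.ChineseRemainder
import Mathlib.Data.ZMod.QuotientRing
import Literature.AnabelianGeometry.AbsoluteAnabelian.FundamentalExtension
import Literature.AnabelianGeometry.AbsoluteAnabelian.AbsTopII.InertiaGroups
import HarnessLib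

/-!
# The intended models of the "`≅ Ẑ`" / "`≅ Ẑ^Σ`" interface predicates: `∏_p ℤ_p` is free
# procyclic, `∏_{p ∈ Σ} ℤ_p` is free pro-`Σ`-cyclic (non-vacuity, transport)

The cell types "the inertia group `I_x` … is naturally isomorphic to `Ẑ(1)`" ([AbsTopIII] Prop. 1.4 (i)
p. 31; `Ẑ` = "the profinite completion of the group `ℤ`", [AbsTopI] §0 p. 7) by abc-iut-L4-t1's
INTRINSIC predicate `FundamentalExtension.IsFreeProcyclic` (a dense cyclic subgroup; an open subgroup
of every positive index), and "as abstract profinite groups, `≅ Ẑ^Σ`" ([AbsTopII] Prop. 1.3 (i)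
p. 11) by abc-iut-L4-t6's `AbsTopII.IsFreeProSigmaCyclic Σ` (a dense cyclic subgroup; the indices of
open subgroups are exactly the `Σ`-integers). abc-iut-L4-t6's `FreeProcyclicStructure.lean` proves
the STRUCTURE half (a profinite group satisfying the predicate is `≃ₜ* ∏_p ℤ_p`). This proof-only
file (no definitions) proves the CONVERSE / NON-VACUITY half:

* `IsFreeProcyclic.of_continuousMulEquiv`, `IsFreeProSigmaCyclic.of_continuousMulEquiv`: both
  predicates are invariant under isomorphisms of topological groups;
* `dense_range_natCast_padicPi`: `ℕ` is dense in `∏_i ℤ_{p_i}` for any injective family of primes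
  (Chinese remainder theorem);
* `exists_isOpen_subgroup_index_padicPi`: for `n ≥ 1` all of whose prime factors occur in the
  family, `∏_i ℤ_{p_i}` has an open subgroup of index exactly `n` (the kernel of the surjection onto
  `ZMod n` given by `PadicInt.toZModPow` and the Chinese remainder theorem `ZMod.equivPi`);
* `not_dvd_index_of_isOpen_padicPi`: a prime `q` outside the family divides the index of no open
  subgroup (`∏_i ℤ_{p_i}` is `q`-divisible);
* hence `isFreeProcyclic_padicProd : IsFreeProcyclic (Multiplicative (∏_p ℤ_p))` — `Ẑ` itself
  satisfies the predicate, so every hypothesis `IsFreeProcyclic (I_x)` in the cell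
  (`CuspidalData.InertiaFreeProcyclic`, `IsCyclotomePresentation.isFreeProcyclic`, …) is satisfiable
  by the intended model — `isFreeProcyclic_ulift_padicProd` for the cell's coefficient object
  `AbsTopIII.ZHatCoeff = ULift (∏_p ℤ_p)` verbatim — and
  `isFreeProSigmaCyclic_padicProdOn S : IsFreeProSigmaCyclic S (Multiplicative (∏_{p ∈ S} ℤ_p))`
  for EVERY set of primes `S` (in particular `S = {l}`: `ℤ_l` satisfies the "`I ≅ ℤ_l`" conjunct of
  [AbsTopI] Lem. 4.5 (iv) as typed in `SatisfiesCuspidalCriterion`).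

Classical profinite group theory [cite: RibesZalesskii2010, Thm 2.7.1]; nothing here bears on
[IUTchIII] Cor. 3.12. The CRT density argument is adapted from abc-iut-L4-t6's
`dense_range_natCast_padicProd` (there for the family of all primes).
-/

noncomputable section

open Topology

namespace Literature.AnabelianGeometry.AbsoluteAnabelian

universe u v

/-! ### Transport of the predicates along isomorphisms of topological groups -/

section Transport

variable {G : Type u} {H : Type v} [Group G] [TopologicalSpace G] [Group H] [TopologicalSpace H]

/-- An isomorphism of topological groups carries a dense cyclic subgroup to a dense cyclic subgroup.
[cite: MochizukiAbsTopI2012, §0 p.7] -/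
theorem dense_zpowers_map_continuousMulEquiv (e : G ≃ₜ* H) {g : G}
    (hg : Dense (Subgroup.zpowers g : Set G)) : Dense (Subgroup.zpowers (e g) : Set H) := by
  have h1 : (Subgroup.zpowers (e g) : Set H) = e '' (Subgroup.zpowers g : Set G) := by
    change (Subgroup.zpowers ((e.toMulEquiv : G →* H) g) : Set H) = _
    rw [← MonoidHom.map_zpowers (e.toMulEquiv : G →* H) g, Subgroup.coe_map]
    rfl
  rw [h1]
  exact e.surjective.denseRange.dense_image e.continuous hg

/-- An isomorphism of topological groups carries an open subgroup of index `n` to an open subgroup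
of index `n`. [cite: MochizukiAbsTopI2012, §0 p.7] -/
theorem exists_isOpen_index_map_continuousMulEquiv (e : G ≃ₜ* H) {n : ℕ}
    (h : ∃ K : Subgroup G, IsOpen (K : Set G) ∧ K.index = n) :
    ∃ K : Subgroup H, IsOpen (K : Set H) ∧ K.index = n := by
  obtain ⟨K, hKo, hKi⟩ := h
  refine ⟨K.map (e.toMulEquiv : G →* H), ?_, ?_⟩
  · rw [Subgroup.coe_map]
    exact e.toHomeomorph.isOpenMap _ hKo
  · rw [Subgroup.index_map_equiv, hKi]

/-- `IsFreeProcyclic` ("`≅ Ẑ`", [AbsTopIII] Prop 1.4 (i)) is invariant under isomorphisms of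
topological groups. [cite: MochizukiAbsTopIII2015, Prop 1.4 (i) p.31] -/
theorem FundamentalExtension.IsFreeProcyclic.of_continuousMulEquiv (e : G ≃ₜ* H)
    (h : FundamentalExtension.IsFreeProcyclic G) : FundamentalExtension.IsFreeProcyclic H where
  exists_dense_zpowers := by
    obtain ⟨g, hg⟩ := h.exists_dense_zpowers
    exact ⟨e g, dense_zpowers_map_continuousMulEquiv e hg⟩
  exists_isOpen_index n hn :=
    exists_isOpen_index_map_continuousMulEquiv e (h.exists_isOpen_index n hn)

/-- `IsFreeProcyclic` is decided by the isomorphism class of the topological group.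
[cite: MochizukiAbsTopIII2015, Prop 1.4 (i) p.31] -/
theorem FundamentalExtension.isFreeProcyclic_congr (e : G ≃ₜ* H) :
    FundamentalExtension.IsFreeProcyclic G ↔ FundamentalExtension.IsFreeProcyclic H :=
  ⟨fun h => h.of_continuousMulEquiv e, fun h => h.of_continuousMulEquiv e.symm⟩

/-- `IsFreeProSigmaCyclic Σ` ("`≅ Ẑ^Σ` as abstract profinite groups", [AbsTopII] Prop 1.3 (i)) is
invariant under isomorphisms of topological groups. [cite: MochizukiAbsTopII2013, Prop 1.3 (i) p.11] -/
theorem AbsTopII.IsFreeProSigmaCyclic.of_continuousMulEquiv {S : Set ℕ} (e : G ≃ₜ* H)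
    (h : AbsTopII.IsFreeProSigmaCyclic S G) : AbsTopII.IsFreeProSigmaCyclic S H where
  exists_dense_zpowers := by
    obtain ⟨g, hg⟩ := h.exists_dense_zpowers
    exact ⟨e g, dense_zpowers_map_continuousMulEquiv e hg⟩
  isOpen_index_iff n := by
    rw [← h.isOpen_index_iff n]
    exact ⟨exists_isOpen_index_map_continuousMulEquiv e.symm,
      exists_isOpen_index_map_continuousMulEquiv e⟩

/-- `IsFreeProSigmaCyclic Σ` is decided by the isomorphism class of the topological group.
[cite: MochizukiAbsTopII2013, Prop 1.3 (i) p.11] -/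
theorem AbsTopII.isFreeProSigmaCyclic_congr {S : Set ℕ} (e : G ≃ₜ* H) :
    AbsTopII.IsFreeProSigmaCyclic S G ↔ AbsTopII.IsFreeProSigmaCyclic S H :=
  ⟨fun h => h.of_continuousMulEquiv e, fun h => h.of_continuousMulEquiv e.symm⟩

end Transport

/-! ### Products of `p`-adic integers over an injective family of primes -/

section PadicPi

variable {ι : Type u} (P : ι → ℕ) [hP : ∀ i, Fact (Nat.Prime (P i))]

/-- **`ℕ` is dense in `∏_i ℤ_{p_i}`** (diagonal embedding) for an injective family of primes: for
finitely many indices and exponents, an integer with prescribed residues mod `p_i^{k_i}` exists (CRT),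
and `m ≡ t_i mod p_i^{k_i}` means `‖m - t_i‖ ≤ p_i^{-k_i}`. (Adapted from abc-iut-L4-t6's
`dense_range_natCast_padicProd`, the case of all primes.) [cite: RibesZalesskii2010, Thm 2.7.1] -/
theorem dense_range_natCast_padicPi (hinj : Function.Injective P) :
    Dense (Set.range (fun m : ℕ => (fun i : ι => ((m : ℕ) : ℤ_[P i])))) := by
  rw [dense_iff_inter_open]
  intro U hU ⟨t, htU⟩
  obtain ⟨I, w, hw, hIU⟩ := isOpen_pi_iff.mp hU t htU
  -- per coordinate in `I`: a radius, then an exponent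
  have hball : ∀ i : ι, i ∈ I → ∃ k : ℕ, ∀ y : ℤ_[P i],
      ‖y - t i‖ ≤ ((P i : ℕ) : ℝ) ^ (-(k : ℤ)) → y ∈ w i := by
    intro i hi
    obtain ⟨ε, hε, hεw⟩ := Metric.isOpen_iff.mp (hw i hi).1 (t i) (hw i hi).2
    obtain ⟨k, hk⟩ := PadicInt.exists_pow_neg_lt (P i) hε
    refine ⟨k, fun y hy => hεw ?_⟩
    rw [Metric.mem_ball, dist_eq_norm]
    exact lt_of_le_of_lt hy hk
  classical
  choose! k hk using hball
  -- CRT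
  let s : ι → ℕ := fun i => (P i) ^ k i
  let a : ι → ℕ := fun i => (PadicInt.toZModPow (k i) (t i)).val
  have hs : ∀ i ∈ I, s i ≠ 0 := fun i _ => (pow_pos (hP i).out.pos _).ne'
  have hcop : Set.Pairwise (↑I : Set ι) (fun i j => Nat.Coprime (s i) (s j)) := by
    intro i _ j _ hij
    have hij' : P i ≠ P j := fun h => hij (hinj h)
    exact ((Nat.coprime_primes (hP i).out (hP j).out).mpr hij').pow _ _
  obtain ⟨m, hm⟩ := Nat.chineseRemainderOfFinset a s I hs hcop
  refine ⟨fun i => ((m : ℕ) : ℤ_[P i]), hIU ?_, ⟨m, rfl⟩⟩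
  rw [Set.mem_pi]
  intro i hi
  apply hk i (Finset.mem_coe.mp hi)
  have hmod : (m : ZMod ((P i) ^ k i)) = PadicInt.toZModPow (k i) (t i) := by
    have h1 := (ZMod.natCast_eq_natCast_iff' m (a i) ((P i) ^ k i)).mpr
      (hm i (Finset.mem_coe.mp hi))
    rw [h1]
    exact ZMod.natCast_zmod_val _
  have hker : ((m : ℕ) : ℤ_[P i]) - t i ∈ Ideal.span {((P i : ℕ) : ℤ_[P i]) ^ k i} := by
    rw [← PadicInt.ker_toZModPow, RingHom.mem_ker, map_sub, map_natCast, hmod, sub_self]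
  exact (PadicInt.norm_le_pow_iff_mem_span_pow _ (k i)).mpr hker

/-- Hence the cyclic subgroup generated by `1` is dense in `∏_i ℤ_{p_i}` (written multiplicatively).
[cite: RibesZalesskii2010, Thm 2.7.1] -/
theorem dense_zpowers_ofAdd_one_padicPi (hinj : Function.Injective P) :
    Dense ((Subgroup.zpowers (Multiplicative.ofAdd (1 : ∀ i, ℤ_[P i]))) :
      Set (Multiplicative (∀ i, ℤ_[P i]))) := by
  have hsub : (Multiplicative.ofAdd : (∀ i, ℤ_[P i]) → Multiplicative (∀ i, ℤ_[P i])) ''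
        Set.range (fun m : ℕ => (fun i : ι => ((m : ℕ) : ℤ_[P i]))) ⊆
      (Subgroup.zpowers (Multiplicative.ofAdd (1 : ∀ i, ℤ_[P i])) : Set _) := by
    rintro _ ⟨_, ⟨m, rfl⟩, rfl⟩
    have h1 : (fun i : ι => ((m : ℕ) : ℤ_[P i])) = m • (1 : ∀ i, ℤ_[P i]) := by
      funext i; simp
    change Multiplicative.ofAdd (fun i : ι => ((m : ℕ) : ℤ_[P i])) ∈ _
    rw [h1, ofAdd_nsmul]
    exact Subgroup.pow_mem _ (Subgroup.mem_zpowers _) _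
  refine Dense.mono hsub ?_
  exact (Multiplicative.ofAdd.surjective.denseRange).dense_image continuous_ofAdd
    (dense_range_natCast_padicPi P hinj)

/-- **The open subgroup of index `n`.** If `n ≥ 1` and every prime factor of `n` occurs in the family,
then `∏_i ℤ_{p_i}` (written multiplicatively) has an open subgroup of index exactly `n`: the kernel of
the surjection `∏_i ℤ_{p_i} ↠ ∏_{q ∣ n} ℤ/q^{v_q(n)} ≅ ℤ/n` (reduction `PadicInt.toZModPow` at the prime
factors, then the Chinese remainder theorem `ZMod.equivPi`). [cite: RibesZalesskii2010, Thm 2.7.1] -/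
theorem exists_isOpen_subgroup_index_padicPi {n : ℕ} (hn : n ≠ 0)
    (hfac : ∀ q ∈ n.primeFactors, ∃ i, P i = q) :
    ∃ K : Subgroup (Multiplicative (∀ i, ℤ_[P i])),
      IsOpen (K : Set (Multiplicative (∀ i, ℤ_[P i]))) ∧ K.index = n := by
  classical
  choose idx hidx using hfac
  -- the component at a prime factor `q`: reduce the `idx q`-coordinate mod `q ^ v_q(n)`
  let φ : ∀ q : n.primeFactors, (∀ i, ℤ_[P i]) →+* ZMod ((q : ℕ) ^ n.factorization q) := fun q =>
    (ZMod.ringEquivCongr (by rw [hidx q q.2])).toRingHom.comp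
      ((PadicInt.toZModPow (p := P (idx q q.2)) (n.factorization q)).comp
        (Pi.evalRingHom (fun i => ℤ_[P i]) (idx q q.2)))
  let ψ : (∀ i, ℤ_[P i]) →+* ZMod n :=
    (ZMod.equivPi n hn).symm.toRingHom.comp (RingHom.pi φ)
  have hsurj : Function.Surjective ψ := ZMod.ringHom_surjective ψ
  let K₀ : AddSubgroup (∀ i, ℤ_[P i]) := ψ.toAddMonoidHom.ker
  -- index
  have hK₀i : K₀.index = n := by
    rw [AddSubgroup.index_ker, AddMonoidHom.range_eq_top.mpr hsurj, AddSubgroup.card_top,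
      Nat.card_zmod]
  -- openness: `K₀` contains the basic neighbourhood `{x | ‖x_{idx q}‖ ≤ q^{-v_q(n)}, q ∣ n}` of `0`
  have hK₀o : IsOpen (K₀ : Set (∀ i, ℤ_[P i])) := by
    apply AddSubgroup.isOpen_of_mem_nhds (g := 0)
    let V : Set (∀ i, ℤ_[P i]) := ⋂ q : n.primeFactors,
      (fun x => x (idx q q.2)) ⁻¹'
        Metric.closedBall 0 (((P (idx q q.2) : ℕ) : ℝ) ^ (-(n.factorization q : ℤ)))
    have hVo : IsOpen V := by
      refine isOpen_iInter_of_finite fun q => ?_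
      refine (IsUltrametricDist.isOpen_closedBall _ ?_).preimage (continuous_apply (idx q q.2))
      exact (zpow_pos (by exact_mod_cast (hP (idx q q.2)).out.pos) _).ne'
    have hV0 : (0 : ∀ i, ℤ_[P i]) ∈ V := by
      refine Set.mem_iInter.mpr fun q => ?_
      change (0 : ℤ_[P (idx q q.2)]) ∈ Metric.closedBall 0 _
      exact Metric.mem_closedBall_self (zpow_pos (by exact_mod_cast (hP (idx q q.2)).out.pos) _).le
    have hVK : V ⊆ (K₀ : Set (∀ i, ℤ_[P i])) := by
      intro x hx
      have hcomp : ∀ q : n.primeFactors, φ q x = 0 := by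
        intro q
        have hq := Set.mem_iInter.mp hx q
        rw [Set.mem_preimage, Metric.mem_closedBall, dist_zero_right,
          PadicInt.norm_le_pow_iff_mem_span_pow, ← PadicInt.ker_toZModPow, RingHom.mem_ker] at hq
        change (ZMod.ringEquivCongr _) (PadicInt.toZModPow (n.factorization q) (x (idx q q.2))) = 0
        rw [hq, map_zero]
      change ψ x = 0
      have hpi : RingHom.pi φ x = 0 := by
        funext q; exact hcomp q
      change (ZMod.equivPi n hn).symm (RingHom.pi φ x) = 0
      rw [hpi, map_zero]
    exact Filter.mem_of_superset (hVo.mem_nhds hV0) hVK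
  refine ⟨AddSubgroup.toSubgroup K₀, ?_, ?_⟩
  · change IsOpen (Multiplicative.toAdd ⁻¹' (K₀ : Set (∀ i, ℤ_[P i])))
    exact hK₀o.preimage continuous_toAdd
  · rw [AddSubgroup.index_toSubgroup, hK₀i]

/-- **`q`-divisibility.** A prime `q` that does not occur in the family divides the index of no open
subgroup of `∏_i ℤ_{p_i}`: `q` is a unit in every `ℤ_{p_i}`, so the `q`-th power map of the
(finite) quotient is surjective, hence injective, which Cauchy's theorem forbids.
[cite: RibesZalesskii2010, Thm 2.7.1] -/
theorem not_dvd_index_of_isOpen_padicPi {q : ℕ} (hq : q.Prime) (hqP : ∀ i, P i ≠ q)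
    (K : Subgroup (Multiplicative (∀ i, ℤ_[P i])))
    (hK : IsOpen (K : Set (Multiplicative (∀ i, ℤ_[P i])))) : ¬ q ∣ K.index := by
  classical
  intro hdvd
  haveI : K.Normal := inferInstance
  haveI : Finite (Multiplicative (∀ i, ℤ_[P i]) ⧸ K) := Subgroup.quotient_finite_of_isOpen K hK
  haveI : Fact q.Prime := ⟨hq⟩
  -- `q` is a unit in each `ℤ_[P i]`
  have hunit : ∀ i, IsUnit ((q : ℕ) : ℤ_[P i]) := by
    intro i
    rw [PadicInt.isUnit_iff, PadicInt.norm_natCast_eq_one_iff]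
    exact (Nat.coprime_primes (hP i).out hq).mpr (hqP i)
  -- the `q`-th power map on the quotient is surjective
  let Q := Multiplicative (∀ i, ℤ_[P i]) ⧸ K
  have hsurjQ : Function.Surjective (fun z : Q => z ^ q) := by
    intro z
    induction z using QuotientGroup.induction_on with
    | H x =>
      obtain ⟨u, hu⟩ : ∃ u : ∀ i, ℤ_[P i], (q : ∀ i, ℤ_[P i]) * u = 1 :=
        ⟨fun i => ((hunit i).unit⁻¹ : (ℤ_[P i])ˣ), funext fun i => by
          change ((q : ℕ) : ℤ_[P i]) * _ = 1
          exact (hunit i).mul_val_inv⟩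
      refine ⟨QuotientGroup.mk (Multiplicative.ofAdd (u * Multiplicative.toAdd x)), ?_⟩
      change QuotientGroup.mk ((Multiplicative.ofAdd (u * Multiplicative.toAdd x)) ^ q) =
        QuotientGroup.mk x
      congr 1
      rw [← ofAdd_nsmul, nsmul_eq_mul, ← mul_assoc, hu, one_mul, ofAdd_toAdd]
  have hinjQ : Function.Injective (fun z : Q => z ^ q) :=
    Finite.injective_iff_surjective.mpr hsurjQ
  -- Cauchy: an element of order `q`
  have hcard : q ∣ Nat.card Q := by rwa [← Subgroup.index]
  obtain ⟨z, hz⟩ := exists_prime_orderOf_dvd_card' q hcard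
  have hz1 : z ^ q = 1 := by rw [← hz]; exact pow_orderOf_eq_one z
  have : z = 1 := hinjQ (by change z ^ q = 1 ^ q; rw [hz1, one_pow])
  rw [this, orderOf_one] at hz
  exact hq.one_lt.ne hz

/-- `∏_i ℤ_{p_i}` is compact, so every open subgroup has positive (finite) index. [folklore] -/
private theorem index_pos_of_isOpen_padicPi (K : Subgroup (Multiplicative (∀ i, ℤ_[P i])))
    (hK : IsOpen (K : Set (Multiplicative (∀ i, ℤ_[P i])))) : 0 < K.index := by
  haveI : Finite (Multiplicative (∀ i, ℤ_[P i]) ⧸ K) := Subgroup.quotient_finite_of_isOpen K hK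
  haveI : K.FiniteIndex := Subgroup.finiteIndex_of_finite_quotient
  exact Nat.pos_of_ne_zero Subgroup.FiniteIndex.index_ne_zero

end PadicPi

/-! ### The models -/

section Models

/-- **`Ẑ = ∏_p ℤ_p` is free procyclic**: the intended model of abc-iut-L4-t1's intrinsic predicate for
"`≅ Ẑ`" ([AbsTopIII] Prop 1.4 (i) "the inertia group `I_x` … is naturally isomorphic to `Ẑ(1)`";
[AbsTopI] §0 p. 7) SATISFIES it — non-vacuity of every `IsFreeProcyclic` hypothesis in the cell.
[cite: MochizukiAbsTopIII2015, Prop 1.4 (i) p.31] -/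
theorem isFreeProcyclic_padicProd :
    FundamentalExtension.IsFreeProcyclic
      (Multiplicative (∀ p : Nat.Primes, @PadicInt (p : ℕ) ⟨p.2⟩)) := by
  refine @FundamentalExtension.IsFreeProcyclic.mk _ _ _ ?_ ?_
  · exact ⟨_, dense_zpowers_ofAdd_one_padicPi (hP := fun p => ⟨p.2⟩) (fun p : Nat.Primes => (p : ℕ))
      Nat.Primes.coe_nat_injective⟩
  · intro n hn
    exact exists_isOpen_subgroup_index_padicPi (hP := fun p => ⟨p.2⟩) (fun p : Nat.Primes => (p : ℕ))
      hn.ne' (fun q hq => ⟨⟨q, Nat.prime_of_mem_primeFactors hq⟩, rfl⟩)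

/-- The same for the cell's coefficient object `AbsTopIII.ZHatCoeff = ULift (∏_p ℤ_p)` verbatim:
`Multiplicative (ULift (∏_p ℤ_p))` is free procyclic. [cite: MochizukiAbsTopIII2015, Prop 1.4 (i) p.31] -/
theorem isFreeProcyclic_ulift_padicProd :
    FundamentalExtension.IsFreeProcyclic
      (Multiplicative (ULift.{v} (∀ p : Nat.Primes, @PadicInt (p : ℕ) ⟨p.2⟩))) := by
  refine isFreeProcyclic_padicProd.of_continuousMulEquiv
    { toFun := fun x => Multiplicative.ofAdd (ULift.up (Multiplicative.toAdd x)),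
      invFun := fun y => Multiplicative.ofAdd (ULift.down (Multiplicative.toAdd y)),
      left_inv := fun _ => rfl,
      right_inv := fun _ => rfl,
      map_mul' := fun _ _ => rfl,
      continuous_toFun := continuous_ofAdd.comp (continuous_uliftUp.comp continuous_toAdd),
      continuous_invFun := continuous_ofAdd.comp (continuous_uliftDown.comp continuous_toAdd) }

/-- **`Ẑ^Σ = ∏_{p ∈ Σ} ℤ_p` is free pro-`Σ`-cyclic** for EVERY set `Σ` (read as a set of primes): the
intended model of abc-iut-L4-t6's intrinsic predicate for "`≅ Ẑ^Σ` as abstract profinite groups"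
([AbsTopII] Prop 1.3 (i)) satisfies it — a dense cyclic subgroup, an open subgroup of index `n` for
every `Σ`-integer `n`, and NO open subgroup whose index has a prime factor outside `Σ`.
[cite: MochizukiAbsTopII2013, Prop 1.3 (i) p.11] -/
theorem isFreeProSigmaCyclic_padicProdOn (S : Set ℕ) :
    AbsTopII.IsFreeProSigmaCyclic S
      (Multiplicative (∀ p : {p : Nat.Primes // (p : ℕ) ∈ S}, @PadicInt (p.1 : ℕ) ⟨p.1.2⟩)) := by
  have hinj : Function.Injective (fun p : {p : Nat.Primes // (p : ℕ) ∈ S} => (p.1 : ℕ)) :=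
    fun a b h => Subtype.ext (Nat.Primes.coe_nat_injective h)
  refine @AbsTopII.IsFreeProSigmaCyclic.mk _ _ _ _ ?_ ?_
  · exact ⟨_, dense_zpowers_ofAdd_one_padicPi (hP := fun p => ⟨p.1.2⟩)
      (fun p : {p : Nat.Primes // (p : ℕ) ∈ S} => (p.1 : ℕ)) hinj⟩
  · intro n
    constructor
    · rintro ⟨K, hKo, hKi⟩
      refine ⟨?_, fun q hq hqn => ?_⟩
      · rw [← hKi]
        exact index_pos_of_isOpen_padicPi (hP := fun p => ⟨p.1.2⟩) _ K hKo
      · by_contra hqS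
        have hne : ∀ i : {p : Nat.Primes // (p : ℕ) ∈ S}, (i.1 : ℕ) ≠ q := by
          intro i h; exact hqS (h ▸ i.2)
        exact not_dvd_index_of_isOpen_padicPi (hP := fun p => ⟨p.1.2⟩) _ hq hne K hKo (hKi ▸ hqn)
    · rintro ⟨hn, hS⟩
      exact exists_isOpen_subgroup_index_padicPi (hP := fun p => ⟨p.1.2⟩) _ hn.ne'
        (fun q hq => ⟨⟨⟨q, Nat.prime_of_mem_primeFactors hq⟩,
          hS q (Nat.prime_of_mem_primeFactors hq) (Nat.dvd_of_mem_primeFactors hq)⟩, rfl⟩)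

/-- In particular (`Σ = {l}`): **`ℤ_l` is free pro-`{l}`-cyclic** — the intended model of the
"`I ≅ ℤ_l`" conjunct of [AbsTopI] Lem. 4.5 (iv) (typed in `SatisfiesCuspidalCriterion` via
`IsFreeProSigmaCyclic {l}`) satisfies it. [cite: MochizukiAbsTopI2012, Lemma 4.5 (iv) p.54] -/
theorem isFreeProSigmaCyclic_singleton_padicInt (l : ℕ) [hl : Fact l.Prime] :
    AbsTopII.IsFreeProSigmaCyclic {l} (Multiplicative ℤ_[l]) := by
  -- `ℤ_l ≅ ∏_{p ∈ {l}} ℤ_p` (a product over a one-point index type)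
  let i₀ : {p : Nat.Primes // (p : ℕ) ∈ ({l} : Set ℕ)} := ⟨⟨l, hl.out⟩, rfl⟩
  have huniq : ∀ i : {p : Nat.Primes // (p : ℕ) ∈ ({l} : Set ℕ)}, i = i₀ :=
    fun i => Subtype.ext (Nat.Primes.coe_nat_injective (i.2.trans rfl))
  haveI : Unique {p : Nat.Primes // (p : ℕ) ∈ ({l} : Set ℕ)} := ⟨⟨i₀⟩, huniq⟩
  -- the evaluation at the unique index, as an isomorphism of topological groups
  have hP0 : ((i₀.1 : ℕ)) = l := rfl
  let e : Multiplicative (∀ p : {p : Nat.Primes // (p : ℕ) ∈ ({l} : Set ℕ)},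
      @PadicInt (p.1 : ℕ) ⟨p.1.2⟩) ≃ₜ* Multiplicative ℤ_[l] :=
    { toFun := fun x => Multiplicative.ofAdd ((Multiplicative.toAdd x) i₀),
      invFun := fun y => Multiplicative.ofAdd (fun i => (huniq i).symm ▸ Multiplicative.toAdd y),
      left_inv := fun x => by
        change Multiplicative.ofAdd (fun i => _) = x
        refine congrArg Multiplicative.ofAdd (funext fun i => ?_)
        cases huniq i; rfl,
      right_inv := fun y => rfl,
      map_mul' := fun _ _ => rfl,
      continuous_toFun := continuous_ofAdd.comp ((continuous_apply i₀).comp continuous_toAdd),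
      continuous_invFun := by
        refine continuous_ofAdd.comp (continuous_pi fun i => ?_)
        cases huniq i
        exact continuous_toAdd }
  exact (isFreeProSigmaCyclic_padicProdOn {l}).of_continuousMulEquiv e

end Models

end Literature.AnabelianGeometry.AbsoluteAnabelian
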